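import Summits.Ventures.QEC.Census.RankCert
import Literature.InformationTheory.QuantumCodes.OptimalRadius
import Literature.InformationTheory.Coding.GolayCodePerfect
import Literature.InformationTheory.QuantumCodes.ParityCheckDuality
import Summits.Ventures.QEC.Census.ClassicalDistCert
import HarnessLib

/-!
# The quantum Golay code `[[23, 1, 7]]` with Paetznick–Reichardt's eleven printed weight-8 generators, CERTIFIED at tier KERNEL

LADDER-QEC (venture cell `qec`), PARTITION row 08 (qec-type-08 gen 6; a calibration-class instance for the Q4 family list,
filed next to the census calibration rows). Source followed (held text `paper:arxiv-1106.2190`, A. Paetznick and B. W. Reichardt,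
*Fault-tolerant ancilla preparation and noise threshold lower bounds for the 23-qubit Golay code*, Quantum Inf. Comput. 12
(2012) 1034, arXiv:1106.2190, §2 "The Golay code", chunk p0006 L3–24):

> «The Golay code is a perfect CSS `[[23,1,7]]` quantum error-correcting code (see e.g., [Steane03]). It has eleven `X` and eleven
> `Z` stabilizer generators. The code is self-dual, and the `X` and `Z` stabilizer generators can both be given by the following
> eleven 23-character strings: [the 11 × 23 table below] Here, the 1s in a row either all indicate `Z` operators or all indicate
> `X` operators, and dots indicate identity operators. … Note that each stabilizer generator has weight eight. We index the qubits
> left to right, from 0 to 22.»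

The eleven printed rows, VERBATIM, as bitmasks (bit `j` = qubit `j`, qubits `0 … 22` left to right as printed):
`.1..1..11111..........1` ↦ `4198290`, `1..1..11111..........1.` ↦ `2099145`, `.11.111...11........1..` ↦ `1051766`,
`11.111...11........1...` ↦ `525883`, `1111...1..11......1....` ↦ `265359`, `1.1.1.111..1.....1.....` ↦ `133589`,
`...1111.11.1....1......` ↦ `68472`, `..1111.11.1....1.......` ↦ `34236`, `.1111.11.1....1........` ↦ `17118`,
`1111.11.1....1.........` ↦ `8559`, `1.1..1..11111..........` ↦ `7973`.

What is here. The CSS code `golayCert.code _` (type-02's `CSSCode` on `Fin 23`, `H^X = H^Z =` the printed rows) and its distance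
certificate in the census format (`Census/CertCheck.lean`, qec-type-10): `golayCert` (both sides `d := 7`, the weight-7 logical
witness `2787` = qubits `{0,1,5,6,7,9,11}`, which is also its own non-membership witness — odd self-overlap —, empty allow-lists since
every nonzero stabilizer has weight `≥ 8`), ★ `check_golayCert : golayCert.checkDistCert = true` by ONE `decide +kernel` (the
brute-force replay: every operator of weight `1 … 6` on 23 qubits has a nonzero syndrome — `Σ_{w≤6} C(23,w) = 145 499` words per
side), rank certificates `r = 11` (`decide`), and the consequences `golay_dZ = 7`, `golay_dX = 7`, ★ **`golay_isCode :
(golayCert.code _).IsCode 23 1 7`** — the printed parameters `[[23,1,7]]` are a CLAIM of the source DISCHARGED by this kernel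
certificate (tier KERNEL = CERTIFIED; axioms ⊆ {propext, Classical.choice, Quot.sound}; no `native_decide`; 0 kit: the certificate
was found in-seat by linear algebra over `𝔽₂`, `work/golay/gen_golay.py` of qec-type-08 gen 6, < 1 s). Q4 (row 08):
`golay_hasOptimalRadius` — optimal Pauli-level correction radius `3`, attained by sector-wise minimum-weight decoding and
unbeatable by any decoder (`Literature/…/OptimalRadius.lean`); `golay_perfect` (below).

IDENTIFICATION with the classical Golay code and PERFECTNESS (second part of the file): along the explicit qubit relabeling
`golayPerm` (PR qubit `i` ↦ MacWilliams–Sloane coordinate; found in-seat by a Steiner-system backtrack, `work/golay/find_perm.py`)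
the kernel of the printed check matrix IS the tree's `𝒢₂₃ = GolayCode.code23` (`Coding/GolayCodePerfect.lean`, MacWilliams–Sloane
Ch. 2 §6): `golay_ker_iff_code23` — so the printed code is `CSS(𝒢₂₃ ⊇ 𝒢₂₃^⊥)` up to the relabeling; the basis images are checked by
`decide`, the converse by counting (`|ker| = 2^{23−11} = 4096 = |𝒢₂₃|`). Hence, through MacWilliams–Sloane Ch. 2 Thm. 28
(`GolayCode.code23_perfect`, PROVED upstream), ★ **`golay_perfect`**: EVERY syndrome of either sector is the syndrome of EXACTLY ONE
error of weight `≤ 3` — the bounded-distance-`3` (minimum-weight) sector decoder's table is total and bijective («perfect CSS code»,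
as printed). HONEST FRAMING: nothing about fault tolerance or thresholds (the subject of the source).

References: [PaetznickReichardt2012] (arXiv:1106.2190 §2, held chunk p0006); [Steane1996Simple] / [Steane2003] as cited there for
the code; [Gottesman1997, §2.3] for the radius.
-/

namespace Summit.Ventures.QEC.Census

open Matrix Literature.InformationTheory.QuantumCodes Literature.InformationTheory.Coding

/-- **The distance certificate of the quantum Golay code** in the census format: `n = 23`, `H^X = H^Z =` Paetznick–Reichardt's
eleven printed generators as bitmasks (bit `j` = qubit `j`), both sides `d := 7` with the weight-7 logical `2787` (qubits
`{0,1,5,6,7,9,11}`) as witness and as its own non-membership witness, empty allow-lists. (definition)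
[cite: PaetznickReichardt2012, §2 (arXiv:1106.2190 chunk p0006 L3-24: the eleven 23-character strings)] -/
def golayCert : DistCert where
  n := 23
  HX := [4198290, 2099145, 1051766, 525883, 265359, 133589, 68472, 34236, 17118, 8559, 7973]
  HZ := [4198290, 2099145, 1051766, 525883, 265359, 133589, 68472, 34236, 17118, 8559, 7973]
  sideZ := { d := 7, witness := 2787, nonmember := 2787, found := [] }
  sideX := { d := 7, witness := 2787, nonmember := 2787, found := [] }

/-- ★ **The certificate passes the kernel checker** (commutation, both weight-7 witnesses, and the brute-force replay: every
`X`- or `Z`-type operator of weight `1 … 6` on the 23 qubits has a nonzero syndrome) — ONE `decide +kernel`; tier KERNEL.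
[cite: PaetznickReichardt2012, §2 (arXiv:1106.2190 chunk p0006: "a perfect CSS [[23,1,7]] quantum error-correcting code")] -/
theorem check_golayCert : golayCert.checkDistCert = true := by
  decide +kernel

/-- The commutation check, naming the code object `golayCert.code golay_commOK`. [cite: PaetznickReichardt2012, §2 (chunk p0006: "The code is self-dual")] -/
theorem golay_commOK : commOK golayCert.n golayCert.HX golayCert.HZ = true :=
  DistCert.commOK_of_check _ check_golayCert

/-- Rank certificate of `H^X`: the eleven printed generators are linearly independent (`r = 11`, right-inverse columns by
Gaussian elimination; `decide`). [cite: PaetznickReichardt2012, §2 (chunk p0006: "eleven X and eleven Z stabilizer generators")] -/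
theorem golay_rankCertX :
    ({ r := 11, pivots := [0, 1, 2, 3, 4, 5, 6, 7, 8, 9, 10],
        rinv := [1393, 1993, 1685, 1595, 1644, 822, 411, 1468, 734, 367, 1478], dependent := [] } : RankCert).check
      golayCert.n golayCert.HX = true := by
  decide

/-- Rank certificate of `H^Z` (the same matrix): `r = 11`. [cite: PaetznickReichardt2012, §2 (chunk p0006)] -/
theorem golay_rankCertZ :
    ({ r := 11, pivots := [0, 1, 2, 3, 4, 5, 6, 7, 8, 9, 10],
        rinv := [1393, 1993, 1685, 1595, 1644, 822, 411, 1468, 734, 367, 1478], dependent := [] } : RankCert).check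
      golayCert.n golayCert.HZ = true := by
  decide

/-- **`d_Z = 7`** for the printed quantum Golay code (CERTIFIED, tier KERNEL). [cite: PaetznickReichardt2012, §2 (chunk p0006: "[[23,1,7]]")] -/
theorem golay_dZ : (golayCert.code golay_commOK).dZ = 7 := DistCert.dZ_code _ check_golayCert

/-- **`d_X = 7`** for the printed quantum Golay code (CERTIFIED, tier KERNEL). [cite: PaetznickReichardt2012, §2 (chunk p0006: "[[23,1,7]]")] -/
theorem golay_dX : (golayCert.code golay_commOK).dX = 7 := DistCert.dX_code _ check_golayCert

/-- ★ **The quantum Golay code is `[[23, 1, 7]]` exactly as printed** — `k = 23 − 11 − 11 = 1`, `d = min d^X d^Z = 7`; the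
printed CLAIM discharged by the kernel certificate. [cite: PaetznickReichardt2012, §2 (arXiv:1106.2190 chunk p0006 L3: "The Golay code is a perfect CSS [[23,1,7]] quantum error-correcting code")] -/
theorem golay_isCode : (golayCert.code golay_commOK).IsCode 23 1 7 :=
  DistCert.isCode_code _ check_golayCert golay_rankCertX golay_rankCertZ (by decide)

/-- **Q4 (PARTITION row 08): the quantum Golay code has OPTIMAL correction radius `3`** — sector-wise minimum-weight decoding
corrects every Pauli error of weight `≤ 3`, and no decoder whatsoever corrects every Pauli error of weight `≤ 4`.
[cite: Gottesman1997, §2.3 (chunk p0014 L3: distance 2t+1 corrects t errors)] -/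
theorem golay_hasOptimalRadius (h : commOK golayCert.n golayCert.HX golayCert.HZ = true) :
    (golayCert.code h).HasOptimalRadius 3 :=
  golay_isCode.hasOptimalRadius_of_eq rfl

/-! ## Identification with MacWilliams–Sloane's `𝒢₂₃` and perfectness -/

/-- The qubit relabeling as a table: Paetznick–Reichardt's qubit `i` corresponds to coordinate `golayPermTab[i]` of the tree's
`𝒢₂₃` (`GolayCode.code23`, coordinates `l_∞, l₀, …, l₁₀, r_∞, r₀, …, r₉` of MacWilliams–Sloane Fig. 2.13 with `r₁₀` deleted).
Found by a backtrack over the Steiner system `S(4,7,23)` of the weight-7 words (qec-type-08 gen 6, `work/golay/find_perm.py`).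
(definition) [cite: MacWilliamsSloane1977, Ch. 2 §6 Definition (p0059-p0060, p0063)] -/
def golayPermTab : List ℕ := [0, 1, 2, 3, 4, 13, 11, 9, 5, 18, 8, 19, 22, 16, 21, 17, 12, 14, 15, 10, 6, 20, 7]

/-- The relabeling `π : Fin 23 → Fin 23` (PR qubit ↦ MS coordinate). (definition) [cite: MacWilliamsSloane1977, Ch. 2 §6 (p0059-p0063)] -/
def golayPerm (i : Fin 23) : Fin 23 := ⟨golayPermTab.getD i 0 % 23, Nat.mod_lt _ (by decide)⟩

/-- `π` is a bijection (`decide`). [cite: MacWilliamsSloane1977, Ch. 2 §6 (p0059-p0063)] -/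
theorem golayPerm_bijective : Function.Bijective golayPerm := by decide

/-- Pull a word on MacWilliams–Sloane's coordinates back to Paetznick–Reichardt's qubits: `(relabel c) i = c (π i)`. (definition)
[cite: MacWilliamsSloane1977, Ch. 2 §6 (p0059-p0063)] -/
def relabel (c : Fin 23 → ZMod 2) : Fin 23 → ZMod 2 := fun i => c (golayPerm i)

/-- `relabel` is additive. [folklore] -/
private theorem relabel_add (c c' : Fin 23 → ZMod 2) : relabel (c + c') = relabel c + relabel c' := rfl

/-- `relabel` is homogeneous. [folklore] -/
private theorem relabel_smul (a : ZMod 2) (c : Fin 23 → ZMod 2) : relabel (a • c) = a • relabel c := rfl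

/-- `relabel` is injective (π is surjective). [folklore] -/
private theorem relabel_injective : Function.Injective relabel := by
  intro c c' h
  funext j
  obtain ⟨i, rfl⟩ := golayPerm_bijective.2 j
  exact congr_fun h i

/-- `relabel` preserves Hamming distances (a coordinate permutation). [folklore] -/
private theorem hammingDist_relabel (u c : Fin 23 → ZMod 2) : hammingDist (relabel u) (relabel c) = hammingDist u c := by
  classical
  unfold hammingDist relabel
  exact Finset.card_bij (fun i _ => golayPerm i) (fun i hi => by simpa using hi)
    (fun i _ j _ h => golayPerm_bijective.1 h) (fun j hj => by
      obtain ⟨i, rfl⟩ := golayPerm_bijective.2 j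
      exact ⟨i, by simpa using hj, rfl⟩)

/-- **The twelve basis words of `𝒢₂₃` (truncated rows of the MacWilliams–Sloane generator matrix), relabeled, are in the kernel
of the printed check matrix** (`12 × 11` parities, `decide`). [cite: PaetznickReichardt2012, §2 (chunk p0006)] [cite: MacWilliamsSloane1977, Ch. 2 §6 Fig. 2.13 (p0059-p0060)] -/
theorem golay_mulVec_relabel_row (i : Fin 12) :
    rowMatrix 23 golayCert.HX *ᵥ relabel (GolayCode.trunc (GolayCode.genMatrix i)) = 0 := by
  revert i
  decide

/-- Every relabeled word of `𝒢₂₃` lies in the kernel of the printed check matrix. [cite: PaetznickReichardt2012, §2 (chunk p0006)] [cite: MacWilliamsSloane1977, Ch. 2 §6 (p0063: 𝒢₂₃)] -/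
theorem golay_mulVec_relabel_eq_zero {c : Fin 23 → ZMod 2} (hc : c ∈ GolayCode.code23) :
    rowMatrix 23 golayCert.HX *ᵥ relabel c = 0 := by
  rw [GolayCode.mem_code23_iff] at hc
  obtain ⟨c24, hc24, rfl⟩ := hc
  rw [GolayCode.mem_code_iff] at hc24
  obtain ⟨msg, rfl⟩ := hc24
  rw [Matrix.vecMul_eq_sum]
  have htr : GolayCode.trunc (∑ i, msg i • GolayCode.genMatrix i) = ∑ i, msg i • GolayCode.trunc (GolayCode.genMatrix i) := by
    funext j; simp [GolayCode.trunc, Finset.sum_apply]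
  rw [htr]
  have hrl : relabel (∑ i, msg i • GolayCode.trunc (GolayCode.genMatrix i)) =
      ∑ i, msg i • relabel (GolayCode.trunc (GolayCode.genMatrix i)) := by
    funext j; simp [relabel, Finset.sum_apply]
  rw [hrl]
  have hlin : ∀ t : Finset (Fin 12),
      rowMatrix 23 golayCert.HX *ᵥ (∑ i ∈ t, msg i • relabel (GolayCode.trunc (GolayCode.genMatrix i))) = 0 := by
    intro t
    induction t using Finset.induction_on with
    | empty => simp
    | insert a t ha ih =>
      rw [Finset.sum_insert ha, Matrix.mulVec_add, Matrix.mulVec_smul, ih, golay_mulVec_relabel_row, smul_zero, add_zero]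
  exact hlin Finset.univ

/-- The kernel of the printed check matrix has dimension `12` (`rank = 11`, rank–nullity), i.e. `2^{12}` words.
[cite: PaetznickReichardt2012, §2 (chunk p0006: "2^{23−11} = 2^{12} inequivalent X errors")] -/
theorem finrank_golay_ker : Module.finrank (ZMod 2) (pcCode (rowMatrix 23 golayCert.HX)) = 12 := by
  have hrank : (rowMatrix 23 golayCert.HX).rank = 11 := rank_rowMatrix_of_rankCert golay_rankCertX rfl
  have hdim := finrank_pcCode_add_finrank_rowSpace (rowMatrix 23 golayCert.HX)
  rw [finrank_rowSpace_eq_rank, hrank, Fintype.card_fin] at hdim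
  omega

/-- ★ **IDENTIFICATION**: along the relabeling `π`, the kernel of Paetznick–Reichardt's check matrix IS MacWilliams–Sloane's Golay
code `𝒢₂₃` — `H v = 0 ↔ v = relabel c` for some `c ∈ 𝒢₂₃`. So the printed quantum Golay code is `CSS(𝒢₂₃ ⊇ 𝒢₂₃^⊥)` with both
check matrices generating `𝒢₂₃^⊥` (up to `π`). (`⊇` by the twelve basis checks; `⊆` by counting: both sides have `4096` words.)
[cite: PaetznickReichardt2012, §2 (chunk p0006: "see e.g. [Steane03]")] [cite: MacWilliamsSloane1977, Ch. 2 §6 Theorem 27 (p0063: 𝒢₂₃ is [23,12,7])] -/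
theorem golay_ker_iff_code23 (v : Fin 23 → ZMod 2) :
    rowMatrix 23 golayCert.HX *ᵥ v = 0 ↔ ∃ c ∈ GolayCode.code23, relabel c = v := by
  classical
  constructor
  · intro hv
    -- the injection `𝒢₂₃ → ker H`, `c ↦ relabel c`, between finite sets of the same size `4096` is onto
    have hcardK : Fintype.card (pcCode (rowMatrix 23 golayCert.HX)) = 4096 := by
      rw [Module.card_eq_pow_finrank (K := ZMod 2), ZMod.card, finrank_golay_ker]; norm_num
    let f : {c // c ∈ GolayCode.code23} → pcCode (rowMatrix 23 golayCert.HX) :=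
      fun c => ⟨relabel c.1, (mem_pcCode_iff _ _).2 (golay_mulVec_relabel_eq_zero c.2)⟩
    have hf : Function.Injective f := by
      intro a b h
      exact Subtype.ext (relabel_injective (congrArg Subtype.val h))
    have hcard_dom : Fintype.card {c // c ∈ GolayCode.code23} = 4096 := by
      rw [Fintype.card_coe, GolayCode.card_code23]
    have hbij : Function.Bijective f :=
      (Fintype.bijective_iff_injective_and_card f).2 ⟨hf, by rw [hcard_dom, hcardK]⟩
    obtain ⟨⟨c, hc⟩, hcv⟩ := hbij.2 ⟨v, (mem_pcCode_iff _ _).2 hv⟩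
    exact ⟨c, hc, congrArg Subtype.val hcv⟩
  · rintro ⟨c, hc, rfl⟩
    exact golay_mulVec_relabel_eq_zero hc

/-- The printed check matrix has full row rank, so every syndrome occurs. [cite: PaetznickReichardt2012, §2 (chunk p0006: "eleven X and eleven Z stabilizer generators")] -/
theorem golay_mulVec_surjective : Function.Surjective (rowMatrix 23 golayCert.HX).mulVec := by
  classical
  have hrank : (rowMatrix 23 golayCert.HX).rank = 11 := rank_rowMatrix_of_rankCert golay_rankCertX rfl
  have hrange : LinearMap.range (rowMatrix 23 golayCert.HX).mulVecLin = ⊤ := by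
    apply Submodule.eq_top_of_finrank_eq
    rw [← Matrix.rank, hrank, Module.finrank_fintype_fun_eq_card, Fintype.card_fin]
    rfl
  intro s
  have hs : s ∈ LinearMap.range (rowMatrix 23 golayCert.HX).mulVecLin := by rw [hrange]; exact Submodule.mem_top
  obtain ⟨e, he⟩ := hs
  exact ⟨e, he⟩

/-- ★ **The quantum Golay code is PERFECT** (as printed: «a perfect CSS [[23,1,7]] quantum error-correcting code»): in either
sector, EVERY syndrome `s ∈ 𝔽₂^{11}` is the syndrome of EXACTLY ONE error of weight `≤ 3` — the bounded-distance-3 (minimum-weight)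
decoder's syndrome table is a bijection between the `2^{11}` syndromes and the `1 + 23 + 253 + 1771 = 2^{11}` errors of weight `≤ 3`.
From MacWilliams–Sloane Ch. 2 Thm. 28 (`𝒢₂₃` is perfect: `GolayCode.code23_perfect`, PROVED upstream) through the identification.
[cite: PaetznickReichardt2012, §2 (arXiv:1106.2190 chunk p0006 L3: "a perfect CSS [[23,1,7]] quantum error-correcting code")] [cite: MacWilliamsSloane1977, Ch. 2 §6 Theorem 28 (p0063: "𝒢₂₃ is a perfect triple-error-correcting code")] -/
theorem golay_perfect (s : Fin golayCert.HX.length → ZMod 2) :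
    ∃! e : Fin 23 → ZMod 2, hammingNorm e ≤ 3 ∧ rowMatrix 23 golayCert.HX *ᵥ e = s := by
  classical
  obtain ⟨u, hu⟩ := golay_mulVec_surjective s
  -- pull `u` back to MS coordinates and use the perfectness of `𝒢₂₃` there
  obtain ⟨σinv, hl, hr⟩ := Function.bijective_iff_has_inverse.1 golayPerm_bijective
  let u' : Fin 23 → ZMod 2 := fun j => u (σinv j)
  have hu' : relabel u' = u := by funext i; simp [relabel, u', hl i]
  obtain ⟨c, ⟨hc, hdist⟩, huniq⟩ := GolayCode.code23_perfect u'
  have hkc : rowMatrix 23 golayCert.HX *ᵥ relabel c = 0 := golay_mulVec_relabel_eq_zero hc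
  refine ⟨u + relabel c, ⟨?_, ?_⟩, ?_⟩
  · -- weight of `u + relabel c` = distance from `u = relabel u'` to `relabel c` = distance from `u'` to `c`
    have : hammingNorm (u + relabel c) = hammingDist u' c := by
      rw [← hammingDist_relabel, hu', hammingDist_eq_hammingNorm]
      congr 1
      funext i
      simp only [Pi.add_apply, CharTwo.neg_eq]
    rw [this]; exact hdist
  · rw [Matrix.mulVec_add, hkc, add_zero, hu]
  · intro e ⟨he, hes⟩
    -- `u + e` is a kernel word within distance `3` of `u`, hence the relabeled `c`
    have hker : rowMatrix 23 golayCert.HX *ᵥ (u + e) = 0 := by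
      rw [Matrix.mulVec_add, hu, hes]; funext i; exact CharTwo.add_self_eq_zero _
    obtain ⟨c', hc', hc'e⟩ := (golay_ker_iff_code23 _).1 hker
    have hd' : hammingDist u' c' ≤ 3 := by
      rw [← hammingDist_relabel, hu', hc'e, hammingDist_eq_hammingNorm]
      have : -u + (u + e) = e := by rw [← add_assoc, neg_add_cancel, zero_add]
      rw [this]; exact he
    have hcc' : c' = c := huniq c' ⟨hc', hd'⟩
    rw [hcc'] at hc'e
    -- `relabel c = u + e` ⇒ `e = u + relabel c`
    have : e = u + relabel c := by
      rw [hc'e]; funext i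
      rw [Pi.add_apply, Pi.add_apply, ← add_assoc, CharTwo.add_self_eq_zero, zero_add]
    exact this


end Summit.Ventures.QEC.Census
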